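/-
Copyright (c) 2026 the pub-hodgecm-mathlib formalisation cell (harness21).  Prover seat hodgecm-mathlib-K2Liu-p06 (g4), Track B «K2-LIT»,
#184♮ = hLiu418 = `stmt-HodgeConjecture-24832`; #42S payer road, organ S1 (local Siegel–Weil spanning), ROAD W file F3c-A (geometry of the big cell,
algebraic half; RULINGS «M-157t», «M-158a»).
-/
import Literature.NumberTheory.K2Lit.LocalSiegelIntertwining     -- ★ `unipDeltaLocal`, `nElem_mem_unipDeltaLocal`, `mul_comm_of_mem_unipDeltaLocal`; ★ local `weylDelta`, `nElem`, `matA`, `adapt`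
import HarnessLib

/-!
# Crux `HLiu418`, #42S organ S1, ROAD W, file F3c-A: THE BIG CELL `P_Δ w_Δ N_Δ = {C invertible}` OF THE LOCAL DOUBLED UNITARY GROUP
# (the algebraic half of the BY-VALUE geometry of ★ F2 ∕ F3a ∕ F3b: `Ω = P w N` as a set, `P·Ω ⊆ Ω`, `w ∈ Ω`, the `N`-coordinate)

Cell `hodgecm-mathlib`, crux item hLiu418 = `stmt-HodgeConjecture-24832`; squad K2 ∕ K2Liu; prover K2Liu-p06 (g4), the dedicated S1 hand.
THEOREMS ONLY (no `def`, no instance, no notation, no named-fact hypothesis, no `sorry`); lane `--supports stmt-HodgeConjecture-24832 --as helper`.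

WHY.  ★ F3b `spanning_criterion` (the (SC) of ROAD W) takes the big cell `Ω = {p·w·u : p ∈ P_Δ, u ∈ N_Δ}` of `H_v = U(𝕍 ⊕ −𝕍)(F_v)` BY VALUE, with
four geometric inputs: `Ω` OPEN, a CONTINUOUS `N_Δ`-coordinate `ν` on `Ω`, `N_Δ` commutative, contracting Levi elements.  This file supplies the
ALGEBRA behind the first two in the tree's adapted-block currency (★ `LocalDoubledUnitaryLagrangians.matA`, ★ `AdaptedBlocks.adapt/blkA/…/blkD`,
★ `LocalDoubledUnitaryIwahori.weylDelta`, ★ `LocalDoubledUnitaryUnramifiedCell.nElem`, ★ `K2Lit/LocalSiegelIntertwining.unipDeltaLocal`):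
* §1 the adapted blocks of `w_Δ` (★ `K2LiuDeltaSpTransportWeylLetter.blocks_matA_weylDelta` states them; re-derived inline from `adapt_matA_weylDelta`) and of `N_Δ(F_v)`; `C(p w u) = D(p)` for `p ∈ P_Δ`, `u ∈ N_Δ`, hence **`P_Δ w_Δ N_Δ ⊆ {C invertible}`**
  (`isUnit_det_blkC_of_siegel_mul_weylDelta_mul_unip`);
* §2 on `{C invertible}` the `N_Δ`-coordinate `t(g) := C⁻¹ D` is `T₀`-SKEW (`skew_blkCInv_mul_blkD`, from the inverse unitarity relation ★ `rel_inv₂₂`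
  `D T⁻¹ Cᴴ + C T⁻¹ Dᴴ = 0`), so `n(t(g)) ∈ N_Δ(F_v)` makes sense, and **`g = p · w_Δ · n(t(g))`** with `p := g n(t)⁻¹ w_Δ ∈ P_Δ` (`C(p) = −C C⁻¹ D + D = 0`)
  (`isSiegelDelta_mul_nElem_inv_mul_weylDelta`, `eq_siegel_mul_weylDelta_mul_nElem`); hence **`{C invertible} ⊆ P_Δ w_Δ N_Δ`** and the two sets COINCIDE
  (`mem_bigCell_iff_isUnit_det_blkC`);
* §3 UNIQUENESS OF THE `N_Δ`-COORDINATE (`eq_of_siegel_mul_weylDelta_mul_eq`: `p w u = p′ w u′ ⇒ u = u′`) and its formula (`t(p w n(t)) = t`), so that the coordinate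
  map `ν` of (SC) is `g ↦ n(C(g)⁻¹ D(g))` on `Ω` (`blkCInv_mul_blkD_siegel_mul_weylDelta_mul_nElem`); `P_Δ · Ω ⊆ Ω`, `Ω · P_Δ ⊆ Ω`-type closure and `w_Δ ∈ Ω`.
The TOPOLOGICAL half (openness of `{C invertible}`, continuity of `g ↦ n(C⁻¹D)` on it, the contracting scalars `m(t)`) is F3c-B.  Everything is generic in
the GR91 local doubled datum `(F, E, c, δ, v, n, T₀)` (any `n`, any finite `v`); the K2Liu CM datum is the instance `F = L⁺, E = L, δ = imagUnit L, T₀ = gramR`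
(bridge ★ `mem_siegelDeltaLoc_iff_local`).
References: [Kudla1994] §3 (adapted blocks, `P_Δ = {C = 0}`, big cell); [Weil1964] n° 32; [GelbartPiatetskishapiroRallis1987] Part A §§1–2 (Bruhat cells of the
doubled group); [HarrisKudlaSweet1996] §1 (1.11).
HONEST LABEL.  Count-neutral helper: `HC_CM` is proved only modulo the 7 printed citations (2 remaining named inputs: hLiu418 = `stmt-HodgeConjecture-24832`,
h413 = `stmt-HodgeConjecture-24833`) until rung 0 closes.
-/

set_option autoImplicit false
set_option linter.dupNamespace false -- the mandated namespace repeats `HodgeConjecture.HodgeConjecture`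

noncomputable section

open NumberField IsDedekindDomain Matrix
open Literature.NumberTheory.Automorphic Literature.NumberTheory.Automorphic.UnitaryGroup
open Literature.NumberTheory.GelbartRogawski1991.AdaptedBlocks
open Literature.NumberTheory.GelbartRogawski1991.UnitaryDualPair.LocalSplitting
open Literature.NumberTheory.K2Lit.LocalSiegelDoubled

namespace Summit.HodgeConjecture.HodgeConjecture.Cruxes.HLiu418.K2LiuLocalSWBigCellDecomposition

variable (F : Type) [Field F] [NumberField F] (E : Type) [Field E] [NumberField E] [Algebra F E]
  (c : E ≃ₐ[F] E)
  {δ : E} (hcδ : c δ = -δ) (hδ : δ ≠ 0) {d : F} (hd : δ * δ = algebraMap F E d)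
  (v : HeightOneSpectrum (𝓞 F)) (n : ℕ) {T₀ : Matrix (Fin n) (Fin n) F} (hT₀ : T₀.IsSymm) (hT₀d : IsUnit T₀.det)
  {JD : Matrix (Fin (n + n)) (Fin (n + n)) E} (hJD : JD = (gramD F n T₀).map (algebraMap F E))

/-! ## §1 Adapted blocks of `w_Δ`, of `N_Δ(F_v)`, of `P_Δ`; `P_Δ w_Δ N_Δ ⊆ {C invertible}` -/

/-- `adapt (matA w_Δ) = [[0, 1], [1, 0]]`. [cite: Kudla1994, §3] -/
theorem adapt_matA_weylDelta : adapt (matA F E c v n (weylDelta F E c v n hJD (T₀ := T₀))) = Matrix.fromBlocks 0 1 1 0 := by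
  rw [weylDelta]
  exact adapt_matA_ofAdapted F E c v n hJD _ _ _

/-- the adapted blocks of `u ∈ N_Δ(F_v)`: `A = 1, C = 0, D = 1`, and `adapt = [[1, B], [0, 1]]`. [cite: Kudla1994, §3] -/
theorem blocks_of_mem_unipDeltaLocal {u : UnitaryGroup.localPi E c (n + n) JD v} (hu : u ∈ unipDeltaLocal F E c v n (JD := JD)) :
    blkA (matA F E c v n u) = 1 ∧ blkC (matA F E c v n u) = 0 ∧ blkD (matA F E c v n u) = 1 := by
  obtain ⟨hC, hA, hD⟩ := (mem_unipDeltaLocal_iff_blocks F E c v n u).1 hu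
  exact ⟨hA, hC, hD⟩

/-- **`C(p · w_Δ · u) = D(p)`** for `C(p) = 0` (`p ∈ P_Δ`) and `u ∈ N_Δ(F_v)`. [cite: Kudla1994, §3] [cite: GelbartPiatetskishapiroRallis1987, Part A §1] -/
theorem blkC_siegel_mul_weylDelta_mul_unip {p u : UnitaryGroup.localPi E c (n + n) JD v} (hp : blkC (matA F E c v n p) = 0)
    (hu : u ∈ unipDeltaLocal F E c v n (JD := JD)) :
    blkC (matA F E c v n (p * weylDelta F E c v n hJD * u)) = blkD (matA F E c v n p) := by
  obtain ⟨hA, hC, -⟩ := blocks_of_mem_unipDeltaLocal F E c v n hu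
  obtain ⟨-, hwB, hwC, hwD⟩ := (by
    have h := adapt_matA_weylDelta F E c v n hJD (T₀ := T₀)
    rw [adapt_eq] at h
    exact Matrix.fromBlocks_inj.1 h)
  rw [← matA_mul, ← matA_mul, blkC_mul, blkC_mul, blkD_mul, hp, hwC, hwD, hwB, hA, hC]
  simp only [Matrix.zero_mul, zero_add, Matrix.mul_one, Matrix.mul_zero, add_zero]

/-- `det D(p)` is a unit for `C(p) = 0` (`det p = det A · det D` is a unit). [cite: Kudla1994, §3] -/
theorem isUnit_det_blkD_of_blkC_eq_zero {p : UnitaryGroup.localPi E c (n + n) JD v} (hp : blkC (matA F E c v n p) = 0) :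
    IsUnit (blkD (matA F E c v n p)).det := by
  have hu := isUnit_det_matA F E c v n p
  rw [det_eq_det_blkA_mul_det_blkD hp] at hu
  exact isUnit_of_mul_isUnit_right hu

include hcδ hδ hd hT₀ in
/-- **`P_Δ · w_Δ · N_Δ ⊆ {C invertible}`**. [cite: Kudla1994, §3] [cite: GelbartPiatetskishapiroRallis1987, Part A §§1–2] -/
theorem isUnit_det_blkC_of_siegel_mul_weylDelta_mul_unip [Algebra.IsQuadraticExtension F E] {p u : UnitaryGroup.localPi E c (n + n) JD v}
    (hp : IsSiegelDelta F E c hcδ hδ hd v n hT₀ hJD p) (hu : u ∈ unipDeltaLocal F E c v n (JD := JD)) :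
    IsUnit (blkC (matA F E c v n (p * weylDelta F E c v n hJD * u))).det := by
  have hp0 := (isSiegelDelta_iff_blkC_eq_zero F E c hcδ hδ hd v n hT₀ hJD p).1 hp
  rw [blkC_siegel_mul_weylDelta_mul_unip F E c v n hJD hp0 hu]
  exact isUnit_det_blkD_of_blkC_eq_zero F E c v n hp0

/-! ## §2 On `{C invertible}`: the coordinate `C⁻¹ D` is skew, and `g = p · w_Δ · n(C⁻¹ D)` -/

include hJD hT₀d in
/-- **on the big cell the `N_Δ`-coordinate `C⁻¹ D` is `T₀`-skew-hermitian**: `(C⁻¹D)ᴴ T + T (C⁻¹D) = 0`, from the inverse unitarity relation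
`D T⁻¹ Cᴴ + C T⁻¹ Dᴴ = 0` (★ `rel_inv₂₂` for ★ `cstar_matA`) by cancelling `C`, `Cᴴ` and conjugating by `T`. [cite: Kudla1994, §3] [cite: Weil1964, n° 32] -/
theorem skew_blkCInv_mul_blkD (g : UnitaryGroup.localPi E c (n + n) JD v) (hC : IsUnit (blkC (matA F E c v n g)).det) :
    (((blkC (matA F E c v n g))⁻¹ * blkD (matA F E c v n g)).map (conjLocal E c v))ᵀ * gramS F E v n T₀ +
      gramS F E v n T₀ * ((blkC (matA F E c v n g))⁻¹ * blkD (matA F E c v n g)) = 0 := by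
  set M := matA F E c v n g with hM
  set C := blkC M with hCdef
  set D := blkD M with hDdef
  set S := gramS F E v n T₀ with hS
  have hSu : IsUnit S.det := isUnit_det_gramS' F E v n hT₀d
  have hrel : D * S⁻¹ * (C.map (conjLocal E c v))ᵀ + C * S⁻¹ * (D.map (conjLocal E c v))ᵀ = 0 :=
    rel_inv₂₂ hSu (isUnit_det_matA F E c v n g) (cstar_matA F E c v n hJD g)
  -- `Cᴴ` is invertible, with inverse `(C⁻¹)ᴴ`
  have hCs : IsUnit ((C.map (conjLocal E c v))ᵀ).det := by
    rw [Matrix.det_transpose, ← RingHom.mapMatrix_apply, ← RingHom.map_det]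
    exact hC.map _
  have hct : ((C.map (conjLocal E c v))ᵀ)⁻¹ = ((C⁻¹).map (conjLocal E c v))ᵀ := by
    refine Matrix.inv_eq_right_inv ?_
    rw [← Matrix.transpose_mul, ← RingHom.mapMatrix_apply, ← RingHom.mapMatrix_apply, ← _root_.map_mul, Matrix.nonsing_inv_mul _ hC,
      _root_.map_one, Matrix.transpose_one]
  -- cancel: `C⁻¹ · (…) · (Cᴴ)⁻¹ = 0` gives `C⁻¹ D S⁻¹ + S⁻¹ Dᴴ (Cᴴ)⁻¹ = 0`
  have key : C⁻¹ * (D * S⁻¹) + S⁻¹ * ((D.map (conjLocal E c v))ᵀ * ((C.map (conjLocal E c v))ᵀ)⁻¹) = 0 := by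
    have h := congrArg (fun X => C⁻¹ * X * ((C.map (conjLocal E c v))ᵀ)⁻¹) hrel
    simp only [Matrix.mul_zero, Matrix.zero_mul, Matrix.mul_add, Matrix.add_mul, Matrix.mul_assoc] at h
    rwa [Matrix.mul_nonsing_inv _ hCs, Matrix.mul_one, Matrix.nonsing_inv_mul_cancel_left _ _ hC] at h
  -- conjugate `key` by `S`
  have h2 := congrArg (fun X => S * X * S) key
  simp only [Matrix.mul_zero, Matrix.zero_mul, Matrix.mul_add, Matrix.add_mul, Matrix.mul_assoc] at h2
  rw [Matrix.nonsing_inv_mul _ hSu, Matrix.mul_one, Matrix.mul_nonsing_inv_cancel_left _ _ hSu, hct] at h2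
  -- `h2 : S (C⁻¹ D) + Dᴴ ((C⁻¹)ᴴ S) = 0`; the goal is `(C⁻¹ D)ᴴ S + S (C⁻¹ D) = 0`
  rw [Matrix.map_mul, Matrix.transpose_mul, add_comm]
  simpa only [Matrix.mul_assoc] using h2

include hcδ hδ hd hT₀ hT₀d in
/-- **the Siegel factor**: for `g` with `C(g)` invertible and `t = C⁻¹D`, the element `p := g · n(t)⁻¹ · w_Δ` lies in `P_Δ` (`C(p) = −C t + D = 0`).
[cite: Kudla1994, §3] [cite: GelbartPiatetskishapiroRallis1987, Part A §§1–2] -/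
theorem isSiegelDelta_mul_nElem_inv_mul_weylDelta [Algebra.IsQuadraticExtension F E] (g : UnitaryGroup.localPi E c (n + n) JD v)
    (hC : IsUnit (blkC (matA F E c v n g)).det) :
    IsSiegelDelta F E c hcδ hδ hd v n hT₀ hJD
      (g * (nElem F E c v n hJD _ (skew_blkCInv_mul_blkD F E c v n hT₀d hJD g hC))⁻¹ * weylDelta F E c v n hJD) := by
  rw [isSiegelDelta_iff_blkC_eq_zero, nElem_inv, ← matA_mul, ← matA_mul, Matrix.mul_assoc, blkC_mul]
  -- blocks of `n(−t) · w_Δ = [[−t, 1], [1, 0]]`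
  have hprod : adapt (matA F E c v n (nElem F E c v n hJD _ (skew_neg F E c v n (skew_blkCInv_mul_blkD F E c v n hT₀d hJD g hC))) *
      matA F E c v n (weylDelta F E c v n hJD (T₀ := T₀))) =
      Matrix.fromBlocks (-((blkC (matA F E c v n g))⁻¹ * blkD (matA F E c v n g))) 1 1 0 := by
    rw [adapt_mul, adapt_matA_nElem, adapt_matA_weylDelta, Matrix.fromBlocks_multiply]
    simp only [Matrix.mul_one, Matrix.mul_zero, zero_add, add_zero]
  rw [adapt_eq] at hprod
  obtain ⟨hA, -, hC', -⟩ := Matrix.fromBlocks_inj.1 hprod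
  rw [hA, hC', Matrix.mul_neg, Matrix.mul_nonsing_inv_cancel_left _ _ hC, Matrix.mul_one, neg_add_cancel]

include hT₀d in
/-- **the big-cell factorisation**: `g = p · w_Δ · n(C⁻¹D)` with `p = g · n(C⁻¹D)⁻¹ · w_Δ` (`w_Δ² = 1`). [cite: Kudla1994, §3] [cite: GelbartPiatetskishapiroRallis1987, Part A §§1–2] -/
theorem eq_siegel_mul_weylDelta_mul_nElem (g : UnitaryGroup.localPi E c (n + n) JD v) (hC : IsUnit (blkC (matA F E c v n g)).det) :
    g = (g * (nElem F E c v n hJD _ (skew_blkCInv_mul_blkD F E c v n hT₀d hJD g hC))⁻¹ * weylDelta F E c v n hJD) *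
        weylDelta F E c v n hJD * nElem F E c v n hJD _ (skew_blkCInv_mul_blkD F E c v n hT₀d hJD g hC) := by
  have hw : ∀ x : UnitaryGroup.localPi E c (n + n) JD v, weylDelta F E c v n hJD (T₀ := T₀) * (weylDelta F E c v n hJD * x) = x :=
    fun x => by rw [← mul_assoc, weylDelta_mul_self, one_mul]
  simp only [mul_assoc, hw, inv_mul_cancel, mul_one]

include hcδ hδ hd hT₀ hT₀d in
/-- **THE BIG CELL OF THE LOCAL DOUBLED UNITARY GROUP**: `g ∈ P_Δ · w_Δ · N_Δ(F_v)` iff `C(g)` is invertible.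
[cite: Kudla1994, §3] [cite: Weil1964, n° 32] [cite: GelbartPiatetskishapiroRallis1987, Part A §§1–2] -/
theorem mem_bigCell_iff_isUnit_det_blkC [Algebra.IsQuadraticExtension F E] (g : UnitaryGroup.localPi E c (n + n) JD v) :
    (∃ p, IsSiegelDelta F E c hcδ hδ hd v n hT₀ hJD p ∧ ∃ u ∈ unipDeltaLocal F E c v n (JD := JD), g = p * weylDelta F E c v n hJD * u) ↔
      IsUnit (blkC (matA F E c v n g)).det := by
  constructor
  · rintro ⟨p, hp, u, hu, rfl⟩
    exact isUnit_det_blkC_of_siegel_mul_weylDelta_mul_unip F E c hcδ hδ hd v n hT₀ hJD hp hu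
  · intro hC
    exact ⟨_, isSiegelDelta_mul_nElem_inv_mul_weylDelta F E c hcδ hδ hd v n hT₀ hT₀d hJD g hC, _,
      nElem_mem_unipDeltaLocal F E c v n hJD _ (skew_blkCInv_mul_blkD F E c v n hT₀d hJD g hC),
      eq_siegel_mul_weylDelta_mul_nElem F E c v n hT₀d hJD g hC⟩

/-! ## §3 Uniqueness of the `N_Δ`-coordinate; `P_Δ·Ω ⊆ Ω`; `w_Δ ∈ Ω` -/

/-- `adapt (matA (p · w_Δ · n(t)))` for `adapt (matA p) = [[a, b], [0, e]]`: `= [[b, a + b t], [e, e t]]`; in particular its `(C, D)` blocks are `(D(p), D(p)·t)`.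
[cite: Kudla1994, §3] -/
theorem blkD_siegel_mul_weylDelta_mul_unip {p u : UnitaryGroup.localPi E c (n + n) JD v} (hp : blkC (matA F E c v n p) = 0)
    (hu : u ∈ unipDeltaLocal F E c v n (JD := JD)) :
    blkD (matA F E c v n (p * weylDelta F E c v n hJD * u)) = blkD (matA F E c v n p) * blkB (matA F E c v n u) := by
  obtain ⟨hA, hC, hD⟩ := blocks_of_mem_unipDeltaLocal F E c v n hu
  obtain ⟨-, hwB, hwC, hwD⟩ := (by
    have h := adapt_matA_weylDelta F E c v n hJD (T₀ := T₀)
    rw [adapt_eq] at h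
    exact Matrix.fromBlocks_inj.1 h)
  rw [← matA_mul, ← matA_mul, blkD_mul, blkC_mul, blkD_mul, hp, hwC, hwD, hwB, hD]
  simp only [Matrix.zero_mul, zero_add, Matrix.mul_one, Matrix.mul_zero, add_zero]

/-- **THE `N_Δ`-COORDINATE**: for `p ∈ P_Δ` (`C(p) = 0`) and `u ∈ N_Δ(F_v)`, `C(p w u)⁻¹ · D(p w u) = B(u)` — the adapted off-diagonal block of `u`, which
determines `u`. [cite: Kudla1994, §3] [cite: GelbartPiatetskishapiroRallis1987, Part A §2 (uniqueness of the unipotent coordinate)] -/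
theorem blkCInv_mul_blkD_siegel_mul_weylDelta_mul_unip {p u : UnitaryGroup.localPi E c (n + n) JD v} (hp : blkC (matA F E c v n p) = 0)
    (hu : u ∈ unipDeltaLocal F E c v n (JD := JD)) :
    (blkC (matA F E c v n (p * weylDelta F E c v n hJD * u)))⁻¹ * blkD (matA F E c v n (p * weylDelta F E c v n hJD * u)) = blkB (matA F E c v n u) := by
  rw [blkC_siegel_mul_weylDelta_mul_unip F E c v n hJD hp hu, blkD_siegel_mul_weylDelta_mul_unip F E c v n hJD hp hu,
    Matrix.nonsing_inv_mul_cancel_left _ _ (isUnit_det_blkD_of_blkC_eq_zero F E c v n hp)]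

/-- an element of `N_Δ(F_v)` is determined by its adapted off-diagonal block `B`. [cite: Kudla1994, §3] -/
theorem eq_of_blkB_eq_of_mem_unipDeltaLocal {u u' : UnitaryGroup.localPi E c (n + n) JD v} (hu : u ∈ unipDeltaLocal F E c v n (JD := JD))
    (hu' : u' ∈ unipDeltaLocal F E c v n (JD := JD)) (h : blkB (matA F E c v n u) = blkB (matA F E c v n u')) : u = u' := by
  obtain ⟨hA, hC, hD⟩ := blocks_of_mem_unipDeltaLocal F E c v n hu
  obtain ⟨hA', hC', hD'⟩ := blocks_of_mem_unipDeltaLocal F E c v n hu'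
  refine matA_injective F E c v n (eq_of_adapt_eq ?_)
  rw [adapt_eq, adapt_eq, hA, hC, hD, hA', hC', hD', h]

include hcδ hδ hd hT₀ in
/-- **UNIQUENESS OF THE `N_Δ`-COORDINATE ON THE BIG CELL**: `p w u = p′ w u′` with `p, p′ ∈ P_Δ`, `u, u′ ∈ N_Δ` forces `u = u′` (then `p = p′`).
[cite: GelbartPiatetskishapiroRallis1987, Part A §2] [cite: Kudla1994, §3] -/
theorem eq_of_siegel_mul_weylDelta_mul_eq [Algebra.IsQuadraticExtension F E] {p p' u u' : UnitaryGroup.localPi E c (n + n) JD v}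
    (hp : IsSiegelDelta F E c hcδ hδ hd v n hT₀ hJD p) (hp' : IsSiegelDelta F E c hcδ hδ hd v n hT₀ hJD p')
    (hu : u ∈ unipDeltaLocal F E c v n (JD := JD)) (hu' : u' ∈ unipDeltaLocal F E c v n (JD := JD))
    (h : p * weylDelta F E c v n hJD * u = p' * weylDelta F E c v n hJD * u') : u = u' := by
  have hp0 := (isSiegelDelta_iff_blkC_eq_zero F E c hcδ hδ hd v n hT₀ hJD p).1 hp
  have hp0' := (isSiegelDelta_iff_blkC_eq_zero F E c hcδ hδ hd v n hT₀ hJD p').1 hp'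
  refine eq_of_blkB_eq_of_mem_unipDeltaLocal F E c v n hu hu' ?_
  rw [← blkCInv_mul_blkD_siegel_mul_weylDelta_mul_unip F E c v n hJD hp0 hu, ← blkCInv_mul_blkD_siegel_mul_weylDelta_mul_unip F E c v n hJD hp0' hu', h]

include hcδ hδ hd hT₀ hT₀d in
/-- on the big cell, the factorisation of §2 recovers the unipotent factor: if `g = p w u` then `n(C(g)⁻¹D(g)) = u`.
[cite: GelbartPiatetskishapiroRallis1987, Part A §2] [cite: Kudla1994, §3] -/
theorem nElem_blkCInv_mul_blkD_eq [Algebra.IsQuadraticExtension F E] {p u : UnitaryGroup.localPi E c (n + n) JD v}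
    (hp : IsSiegelDelta F E c hcδ hδ hd v n hT₀ hJD p) (hu : u ∈ unipDeltaLocal F E c v n (JD := JD))
    (hC : IsUnit (blkC (matA F E c v n (p * weylDelta F E c v n hJD * u))).det) :
    nElem F E c v n hJD _ (skew_blkCInv_mul_blkD F E c v n hT₀d hJD _ hC) = u :=
  (eq_of_siegel_mul_weylDelta_mul_eq F E c hcδ hδ hd v n hT₀ hJD
    (isSiegelDelta_mul_nElem_inv_mul_weylDelta F E c hcδ hδ hd v n hT₀ hT₀d hJD _ hC) hp
    (nElem_mem_unipDeltaLocal F E c v n hJD _ _) hu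
    (eq_siegel_mul_weylDelta_mul_nElem F E c v n hT₀d hJD _ hC).symm)

include hcδ hδ hd hT₀ in
/-- **`P_Δ · Ω ⊆ Ω`**. [cite: Kudla1994, §3] -/
theorem siegel_mul_mem_bigCell [Algebra.IsQuadraticExtension F E] {q x : UnitaryGroup.localPi E c (n + n) JD v}
    (hq : IsSiegelDelta F E c hcδ hδ hd v n hT₀ hJD q)
    (hx : ∃ p, IsSiegelDelta F E c hcδ hδ hd v n hT₀ hJD p ∧ ∃ u ∈ unipDeltaLocal F E c v n (JD := JD), x = p * weylDelta F E c v n hJD * u) :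
    ∃ p, IsSiegelDelta F E c hcδ hδ hd v n hT₀ hJD p ∧ ∃ u ∈ unipDeltaLocal F E c v n (JD := JD), q * x = p * weylDelta F E c v n hJD * u := by
  obtain ⟨p, hp, u, hu, rfl⟩ := hx
  exact ⟨q * p, hq.mul hp, u, hu, by rw [mul_assoc, mul_assoc, mul_assoc]⟩

include hcδ hδ hd hT₀ in
/-- **`w_Δ ∈ Ω`** (`w_Δ = 1 · w_Δ · 1`). [cite: Kudla1994, §3] -/
theorem weylDelta_mem_bigCell [Algebra.IsQuadraticExtension F E] :
    ∃ p, IsSiegelDelta F E c hcδ hδ hd v n hT₀ hJD p ∧ ∃ u ∈ unipDeltaLocal F E c v n (JD := JD),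
      weylDelta F E c v n hJD = p * weylDelta F E c v n hJD * u :=
  ⟨1, (isSiegelDelta_iff_blkC_eq_zero F E c hcδ hδ hd v n hT₀ hJD 1).2 (by rw [matA_one, blkC_one]), 1, Subgroup.one_mem _,
    by rw [one_mul, mul_one]⟩

/-- **`N_Δ(F_v)` is commutative** (re-export of ★ `mul_comm_of_mem_unipDeltaLocal` in the binder shape of ★ F3b `spanning_criterion`). [cite: HarrisKudlaSweet1996, §1 (1.11)] -/
theorem unipDeltaLocal_comm : ∀ x ∈ unipDeltaLocal F E c v n (JD := JD), ∀ y ∈ unipDeltaLocal F E c v n (JD := JD), x * y = y * x :=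
  fun _ hx _ hy => mul_comm_of_mem_unipDeltaLocal F E c v n hx hy

end Summit.HodgeConjecture.HodgeConjecture.Cruxes.HLiu418.K2LiuLocalSWBigCellDecomposition

end
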